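import Literature.Geometry.Riemannian.FlowC2AlphaNorm
import Literature.Topology.Metrizable.KuratowskiLimit
import Mathlib.Analysis.InnerProductSpace.Adjoint
import Mathlib.Topology.UniformSpace.UniformApproximation
import HarnessLib

/-!
# Kuratowski limits of parabolic graphs

Topic `Literature/Geometry/Riemannian`.  If, inside an open region `C` of spacetime, the sets `Sᵢ`
are exactly the parabolic graphs of functions `uᵢ ⊥ range L` over an open parameter region `D`,
and `uᵢ → u` locally uniformly on `D` with `u` continuous, then the (lower) Kuratowski limit
`K = {Y : ∀ open O ∋ Y, ∀ᶠ i, Sᵢ meets O}` (cf. `Topology/Metrizable/KuratowskiLimit.lean`) is,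
inside `C` and above `D`, exactly the parabolic graph of `u`:

* `parabolicGraph_inter_subset_lowerLimit` — `graph(u|D) ∩ C ⊆ K`;
* `lowerLimit_inter_subset_parabolicGraph` — `K ∩ C ∩ π⁻¹(D) ⊆ graph(u|D)`, `π Y = (L† Y.x, Y.t)`.

This identifies the blow-up limit of a sequence of flows with locally uniform `K_{2,α}` bounds as
the track described by the limits of the graph functions (White 2005, §2.6 and p. 1498).

Everything is PROVED; no definitions, no named facts.

## References

* B. White, *A local regularity theorem for mean curvature flow*, Ann. of Math. 161 (2005), §2.6.
  [White2005]
* K. Kuratowski, *Topology I*, Academic Press 1966, §29. [Kuratowski1966]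
-/

noncomputable section

open scoped Topology InnerProductSpace
open Filter

namespace Literature.Geometry.Riemannian

open Literature.Analysis.PDE Literature.Analysis.PDE.Parabolic Metric Set

namespace ParabolicFlow

variable {N m : ℕ}

/-- The adjoint of a linear isometry inverts it: `L† (L x) = x`. [folklore] -/
theorem adjoint_apply_map (L : EuclideanSpace ℝ (Fin m) →ₗᵢ[ℝ] EuclideanSpace ℝ (Fin N))
    (x : EuclideanSpace ℝ (Fin m)) : L.toContinuousLinearMap.adjoint (L x) = x := by
  refine ext_inner_right ℝ fun z => ?_
  rw [ContinuousLinearMap.adjoint_inner_left]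
  exact L.inner_map_map x z

/-- The adjoint of a linear isometry kills vectors orthogonal to its range. [folklore] -/
theorem adjoint_apply_eq_zero (L : EuclideanSpace ℝ (Fin m) →ₗᵢ[ℝ] EuclideanSpace ℝ (Fin N))
    {v : EuclideanSpace ℝ (Fin N)} (hv : ∀ η, ⟪v, L η⟫_ℝ = 0) :
    L.toContinuousLinearMap.adjoint v = 0 := by
  refine ext_inner_right ℝ fun z => ?_
  rw [ContinuousLinearMap.adjoint_inner_left, inner_zero_left]
  exact hv z

/-- The parameter of a graph point: `L† (L x + u X) = x` for `u ⊥ range L`. [folklore] -/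
theorem adjoint_apply_graphPoint (L : EuclideanSpace ℝ (Fin m) →ₗᵢ[ℝ] EuclideanSpace ℝ (Fin N))
    {u : Parabolic (EuclideanSpace ℝ (Fin m)) → EuclideanSpace ℝ (Fin N)}
    (hu : ∀ X η, ⟪u X, L η⟫_ℝ = 0) (x : EuclideanSpace ℝ (Fin m))
    (X : Parabolic (EuclideanSpace ℝ (Fin m))) :
    L.toContinuousLinearMap.adjoint (L x + u X) = x := by
  rw [map_add, adjoint_apply_map, adjoint_apply_eq_zero L (hu X), add_zero]

/-- Convergence of parabolic points from their coordinates. [folklore] -/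
theorem tendsto_parabolic_mk {ι : Type*} {l : Filter ι} {E : Type*} [NormedAddCommGroup E]
    {a : ι → E} {b : ι → ℝ} {a₀ : E} {b₀ : ℝ} (ha : Tendsto a l (𝓝 a₀))
    (hb : Tendsto b l (𝓝 b₀)) :
    Tendsto (fun i => (⟨a i, b i⟩ : Parabolic E)) l (𝓝 ⟨a₀, b₀⟩) :=
  ((homeomorphProd (E := E)).symm.continuous.tendsto (a₀, b₀)).comp (ha.prodMk_nhds hb)

/-- **The limit graph lies in the Kuratowski limit**: if `graph(uᵢ|D) ∩ C ⊆ Sᵢ` for all `i`, `C`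
is open and `uᵢ → u` pointwise on `D`, then `graph(u|D) ∩ C ⊆ K`. [cite: White2005, §2.6] -/
theorem parabolicGraph_inter_subset_lowerLimit
    (L : EuclideanSpace ℝ (Fin m) →ₗᵢ[ℝ] EuclideanSpace ℝ (Fin N))
    {u : ℕ → Parabolic (EuclideanSpace ℝ (Fin m)) → EuclideanSpace ℝ (Fin N)}
    {u₀ : Parabolic (EuclideanSpace ℝ (Fin m)) → EuclideanSpace ℝ (Fin N)}
    {D : Set (Parabolic (EuclideanSpace ℝ (Fin m)))}
    {C : Set (Parabolic (EuclideanSpace ℝ (Fin N)))}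
    (hC : IsOpen C) {S : ℕ → Set (Parabolic (EuclideanSpace ℝ (Fin N)))}
    (hS : ∀ i, parabolicGraph L (u i) D ∩ C ⊆ S i)
    (hconv : ∀ X ∈ D, Tendsto (fun i => u i X) atTop (𝓝 (u₀ X))) :
    parabolicGraph L u₀ D ∩ C ⊆
      {Y | ∀ O : Set (Parabolic (EuclideanSpace ℝ (Fin N))), IsOpen O → Y ∈ O →
        ∀ᶠ i in atTop, (S i ∩ O).Nonempty} := by
  rintro Y ⟨hYg, hYC⟩ O hO hYO
  obtain ⟨X, hXD, rfl⟩ := mem_parabolicGraph.1 hYg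
  -- the approximating graph points
  have ht : Tendsto (fun i => (⟨L X.x + u i X, X.t⟩ : Parabolic (EuclideanSpace ℝ (Fin N)))) atTop
      (𝓝 ⟨L X.x + u₀ X, X.t⟩) :=
    tendsto_parabolic_mk (tendsto_const_nhds.add (hconv X hXD)) tendsto_const_nhds
  have hevC := ht (hC.mem_nhds hYC)
  have hevO := ht (hO.mem_nhds hYO)
  filter_upwards [hevC, hevO] with i hiC hiO
  exact ⟨_, hS i ⟨mem_parabolicGraph.2 ⟨X, hXD, rfl⟩, hiC⟩, hiO⟩

/-- **The Kuratowski limit lies in the limit graph** (inside `C`, above `D`): if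
`Sᵢ ∩ C ⊆ graph(uᵢ|D)`, `C` is open, `uᵢ ⊥ range L`, `uᵢ → u` locally uniformly on `D`
and `u` is continuous on `D`, then every `Y ∈ K ∩ C` with `(L† Y.x, Y.t) ∈ D` lies on
`graph(u|D)`. [cite: White2005, §2.6] -/
theorem lowerLimit_inter_subset_parabolicGraph
    (L : EuclideanSpace ℝ (Fin m) →ₗᵢ[ℝ] EuclideanSpace ℝ (Fin N))
    {u : ℕ → Parabolic (EuclideanSpace ℝ (Fin m)) → EuclideanSpace ℝ (Fin N)}
    {u₀ : Parabolic (EuclideanSpace ℝ (Fin m)) → EuclideanSpace ℝ (Fin N)}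
    (hu : ∀ i X η, ⟪u i X, L η⟫_ℝ = 0)
    {D : Set (Parabolic (EuclideanSpace ℝ (Fin m)))}
    {C : Set (Parabolic (EuclideanSpace ℝ (Fin N)))} (hC : IsOpen C)
    {S : ℕ → Set (Parabolic (EuclideanSpace ℝ (Fin N)))}
    (hS : ∀ i, S i ∩ C ⊆ parabolicGraph L (u i) D)
    (hconv : TendstoLocallyUniformlyOn u u₀ atTop D) (hu₀ : ContinuousOn u₀ D)
    {Y : Parabolic (EuclideanSpace ℝ (Fin N))}
    (hY : ∀ O : Set (Parabolic (EuclideanSpace ℝ (Fin N))), IsOpen O → Y ∈ O →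
      ∀ᶠ i in atTop, (S i ∩ O).Nonempty)
    (hYC : Y ∈ C) (hYD : (⟨L.toContinuousLinearMap.adjoint Y.x, Y.t⟩ : Parabolic _) ∈ D) :
    Y ∈ parabolicGraph L u₀ D := by
  -- points `Zᵢ ∈ Sᵢ` converging to `Y`
  obtain ⟨Z, hZS, hZ⟩ := Literature.Topology.Metrizable.exists_tendsto_of_mem_lowerLimit
    (M := S) (φ := id) hY
  have hZC : ∀ᶠ i in atTop, Z i ∈ C := hZ (hC.mem_nhds hYC)
  -- their parameters `Ξᵢ = (L† Zᵢ.x, Zᵢ.t) → X₀ = (L† Y.x, Y.t)`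
  set X₀ : Parabolic (EuclideanSpace ℝ (Fin m)) := ⟨L.toContinuousLinearMap.adjoint Y.x, Y.t⟩
    with hX₀
  set Ξ : ℕ → Parabolic (EuclideanSpace ℝ (Fin m)) :=
    fun i => ⟨L.toContinuousLinearMap.adjoint (Z i).x, (Z i).t⟩ with hΞ
  have hZx : Tendsto (fun i => (Z i).x) atTop (𝓝 Y.x) := (continuous_x.tendsto Y).comp hZ
  have hZt : Tendsto (fun i => (Z i).t) atTop (𝓝 Y.t) := (continuous_t.tendsto Y).comp hZ
  have hΞlim : Tendsto Ξ atTop (𝓝 X₀) :=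
    tendsto_parabolic_mk ((L.toContinuousLinearMap.adjoint.continuous.tendsto _).comp hZx) hZt
  -- eventually `Zᵢ` is the graph point over `Ξᵢ ∈ D`
  have hgraph : ∀ᶠ i in atTop, Ξ i ∈ D ∧ Z i = ⟨L (Ξ i).x + u i (Ξ i), (Ξ i).t⟩ := by
    filter_upwards [hZS, hZC] with i hiS hiC
    obtain ⟨X, hXD, hXZ⟩ := mem_parabolicGraph.1 (hS i ⟨hiS, hiC⟩)
    have hx : (Z i).x = L X.x + u i X := (congrArg Parabolic.x hXZ).symm
    have ht : (Z i).t = X.t := (congrArg Parabolic.t hXZ).symm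
    have hΞX : Ξ i = X := by
      rw [hΞ]
      ext1
      · show L.toContinuousLinearMap.adjoint (Z i).x = X.x
        rw [hx, adjoint_apply_graphPoint L (hu i)]
      · exact ht
    refine ⟨hΞX ▸ hXD, ?_⟩
    rw [hΞX]; exact hXZ.symm
  -- pass to the limit: `Y = (L X₀.x + u₀ X₀, X₀.t)`
  have hΞD : ∀ᶠ i in atTop, Ξ i ∈ D := hgraph.mono fun i hi => hi.1
  have hΞwithin : Tendsto Ξ atTop (𝓝[D] X₀) :=
    tendsto_nhdsWithin_iff.2 ⟨hΞlim, hΞD⟩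
  have huconv : Tendsto (fun i => u i (Ξ i)) atTop (𝓝 (u₀ X₀)) :=
    hconv.tendsto_comp (hu₀.continuousWithinAt hYD) hYD hΞwithin
  have hlim : Tendsto (fun i => (⟨L (Ξ i).x + u i (Ξ i), (Ξ i).t⟩ :
      Parabolic (EuclideanSpace ℝ (Fin N)))) atTop (𝓝 ⟨L X₀.x + u₀ X₀, X₀.t⟩) := by
    have hx : Tendsto (fun i => (Ξ i).x) atTop (𝓝 X₀.x) := (continuous_x.tendsto X₀).comp hΞlim
    have ht : Tendsto (fun i => (Ξ i).t) atTop (𝓝 X₀.t) := (continuous_t.tendsto X₀).comp hΞlim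
    exact tendsto_parabolic_mk (((L.continuous.tendsto _).comp hx).add huconv) ht
  have hlim' : Tendsto Z atTop (𝓝 ⟨L X₀.x + u₀ X₀, X₀.t⟩) :=
    hlim.congr' (hgraph.mono fun i hi => hi.2.symm)
  have hYeq : Y = ⟨L X₀.x + u₀ X₀, X₀.t⟩ := tendsto_nhds_unique hZ hlim'
  exact mem_parabolicGraph.2 ⟨X₀, hYD, hYeq.symm⟩

end ParabolicFlow

end Literature.Geometry.Riemannian
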